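import Literature.AlgebraicGeometry.AbelianSchemes.PolarizedAbelianSchemeLocalEmbedding
import Literature.AlgebraicGeometry.Morphisms.ProjectiveOfFibrewiseVeryAmple
import HarnessLib

/-!
# REL-EMB-SPREAD for a bare rank-one `L` with symmetric ample characteristic-`0` witnesses: over a Dedekind base of characteristic `0` an
# abelian scheme carrying such an `L` is PROJECTIVE on affine charts of an open `𝒱 ⊇` generic fibre whose complement lies over finitely many primes

Layer `Literature/AlgebraicGeometry/AbelianSchemes`, namespace `Literature.AlgebraicGeometry.AbelianSchemes.AbelianSchemeOver`.  THEOREMS ONLY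
(no definition, no named fact, no instance, no notation, no `sorry`); universe `Scheme.{0}` (that of ★ «REL-EMB-SPREAD»).  Cell `hodgecm-mathlib`
(D-0151), P6 «MOD programme», L4 DUALS road, organ **(O4-ε)** of the stage Mumford-bundle package (LEAD F0P6-plan (g3) «M-55c» 2026-09-02; LA4-p05 (g0)):
the PROJECTIVITY binder `(hA : IsProjective A.X.hom)` of the re-typed socket `stub_DUALS : DualPairOfAmpleRigidified` on the affine charts of a
shrunken stage.  HC_CM is proved only modulo the printed citations (2 remaining named inputs hLiu418 24832, h413 24833) until rung 0 closes; this
file is generic abelian-scheme geometry and changes no count.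

★ `PolarizedAbelianSchemeLocalEmbedding` §4 (B-p10 (g29)) proves the spread for the Mumford bundle `L^Δ(λ)` of a POLARISATION `pol` of `𝒜∕T`.
The DUALS road needs it BEFORE a polarisation exists at the stage, for a rank-one `L` (the stage spread of the generic `L^Δ(λ_E)`) given only
with its fibre data at the characteristic-`0` geometric points: an ample SYMMETRIC Cartier divisor `Θ` with `[L|_{A_x̄}] = [Θ]` in `Ȟ¹(A_x̄, 𝒪^×)`
(the output currency of ★ B10 `LDeltaRigidifiedFibrewiseAmple` — witness `Θ₁ + (−1)^*Θ₁` — and of the letter's `hΘ`).  Same proof as ★ §4,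
the chart step being ★ §2 `exists_affineOpen_isClosedImmersion_toProj_tensorPow_three_of_symmetric_isAmple` (rank-one `L`, symmetric ample
char-`0` witness; [MumfordAV1970] §16–§17 + [EGAIII1] (4.7.1) in the tree's flat + `H¹` spine):

* §1 `exists_affineOpen_isClosedImmersion_toProj_tensorPow_three_of_cechClass` — the chart at ONE point `x` under an algebraically closed
  char-`0` point `x̄` centred at `x` with a symmetric ample CLASS witness (class ⇒ module isomorphism `L| ≅ 𝒪(Θ)` by ★ `nonempty_iso_iff_detClass_eq`).
* §2 **`exists_opens_finite_image_compl_forall_affineOpen_isClosedImmersion_toProj_of_cechClass`** — `T` Noetherian, `q : T → Spec B` locally of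
  finite type, `B` Dedekind of characteristic `0`, `𝒜∕T` abelian, `L` rank one with a rank-one frame system `F` of `L^{⊗3}`, and (`hwit`) at every
  algebraically closed characteristic-`0` point `x̄` of `T` an ample symmetric `Θ` with `[L|_{A_x̄}] = [Θ]`: THEN there is an OPEN `𝒱 ⊆ T` with
  `q(T ∖ 𝒱)` FINITE, `𝒱 ⊇` the generic fibre, and every `t ∈ 𝒱` in an affine open `Spec R ↪ 𝒱` (`R` Noetherian) over which, for every cartesian
  square `A′ = A ×_T Spec R`, finitely many sections of `L^{⊗3}|_{A′}` generate it and embed `A′ ↪ ℙ^m_R` over `Spec R`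
  (★ §3 `charZero_residueField_of_apply_eq_bot`, ★ SP3-b `finite_image_of_isConstructible_of_bot_notMem_of_finiteType`).
* §3 **`exists_opens_finite_image_compl_forall_affineOpen_isProjective_of_cechClass`** — the same read as PROJECTIVITY of the chart schemes:
  every `t ∈ 𝒱` lies in the range of an affine open immersion `ι : Spec R ↪ 𝒱` with `IsProjective (pullback.snd 𝒜.X.hom ι)` (★
  `IsProjective.of_generatingSections`) — the `hA` binder of `DualPairOfAmpleRigidified` for `𝒜.baseChange ι` (★ `baseChange_hom`).

The consumer (chain step (4), B-p18 (g39) ∕ LA4-p01) inverts the finitely many non-zero bad primes (`t ↦ t · ∏ 𝔭`, they join `S_M`); on the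
shrunken stage `𝒱` is everything, so EVERY point of the stage base has a projective affine chart.

## References
* [EGAIII1] A. Grothendieck, J. Dieudonné, *EGA III₁* (1961), Thm. (4.7.1) (p. 145).
* [EGAIV3] A. Grothendieck, J. Dieudonné, *EGA IV₃* (1966), (9.2.1)–(9.2.3).
* [MumfordAV1970] D. Mumford, *Abelian Varieties* (1970), §16 (the vanishing theorem), §17 (Lefschetz), §5 Cor. 2–3 (pp. 50–53).
* [MumfordFogartyKirwan1994] D. Mumford, J. Fogarty, F. Kirwan, *Geometric Invariant Theory*, 3rd ed. (1994), Ch. 7 §2 Prop. 7.6 (p. 136).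
* [Hartshorne1977] R. Hartshorne, *Algebraic Geometry* (1977), II §4 (projective morphisms, p. 103), II Thm. 7.1.
* [StacksProject] The Stacks Project, Tags 0D2N, 00FE, 054J.
-/

noncomputable section

-- `TopCat.Presheaf`/`Scheme.Modules` and pull-back bookkeeping (as in ★ `AbelianSchemes/PolarizedAbelianSchemeLocalEmbedding`).
set_option backward.isDefEq.respectTransparency false

open CategoryTheory CategoryTheory.Limits CategoryTheory.Abelian AlgebraicGeometry TopologicalSpace Opposite

namespace Literature.AlgebraicGeometry.AbelianSchemes

namespace AbelianSchemeOver

open Literature.AlgebraicGeometry.Morphisms Literature.AlgebraicGeometry.Modules Literature.AlgebraicGeometry.Motives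
open Literature.AlgebraicGeometry.Motives.GeneratingSections Literature.AlgebraicGeometry.AbelianVarieties
open Literature.AlgebraicGeometry.Limits _root_.Topology

/-! ## §1 The chart at one point, from a symmetric ample CLASS witness at an algebraically closed char-`0` point -/

section Chart

variable {T : Scheme.{0}} [IsLocallyNoetherian T] (𝒜 : AbelianSchemeOver T)

/-- **REL-EMB chart for a rank-one `L` with a symmetric ample CLASS witness** at an algebraically closed char-`0` point `x̄` centred at `x`:
`[L|_{A_x̄}] = [Θ]` with `Θ` ample and `(−1)^*Θ ∼ Θ` ⇒ an affine open `Spec R ↪ T` through `x` over which sections of `L^{⊗3}|` embed every cartesian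
`A ×_T Spec R ↪ ℙ^m_R` (class ⇒ `L| ≅ 𝒪(Θ)` for rank-one modules, ★ `nonempty_iso_iff_detClass_eq`; then ★
`exists_affineOpen_isClosedImmersion_toProj_tensorPow_three_of_symmetric_isAmple`).
[cite: EGAIII1, Thm. (4.7.1) p. 145] [cite: MumfordAV1970, §16 (the vanishing theorem) and §17 (Lefschetz)] -/
theorem exists_affineOpen_isClosedImmersion_toProj_tensorPow_three_of_cechClass (L : 𝒜.X.left.Modules) (hL : HasRank L 1)
    (F : FrameSystem (tensorPow L 3)) (h1 : ∀ x, F.rank x = 1) (x : T)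
    {Ω : Type} [Field Ω] [IsAlgClosed Ω] [CharZero Ω] (xb : Spec (.of Ω) ⟶ T) (hx : x ∈ Set.range xb)
    {Θ : CartierDivisor (𝒜.fibre xb).toAbelianVariety.X.left} (hΘ : Θ.IsAmple)
    (hsym : (Θ.pullback (AbelianVariety.Hom.toSchemeHom (-𝟙 (𝒜.fibre xb).toAbelianVariety))).LinEquiv Θ)
    (hcl : CechPic.pullback (X := (𝒜.fibre xb).toAbelianVariety.X.left) (pullback.fst 𝒜.X.hom xb)
      (detClass (HasRank.isFiniteLocallyFree' hL)) = Θ.cechClass) :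
    ∃ (R : Type) (_ : CommRing R) (_ : IsNoetherianRing R) (ι : Spec (.of R) ⟶ T) (_ : IsOpenImmersion ι), x ∈ Set.range ι ∧
      ∀ {X' : Scheme.{0}} (i' : X' ⟶ 𝒜.X.left) (f' : X' ⟶ Spec (.of R)), IsPullback i' f' 𝒜.X.hom ι →
        ∃ (m : ℕ) (b : Fin (m + 1) → Γ((Scheme.Modules.pullback i').obj (tensorPow L 3), ⊤))
          (hcov' : ⨆ i, ⨆ z, X'.basicOpen ((CocycleSections.ofFrameSystem (F.pullback i') (fun z ↦ h1 (i'.base z))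
            b).coeff i z) = ⊤),
          IsClosedImmersion ((ofCocycleSections (F.pullback i').U (CocycleSections.ofFrameSystem (F.pullback i')
            (fun z ↦ h1 (i'.base z)) b) hcov').toProj f') := by
  let B := (𝒜.fibre xb).toAbelianVariety
  haveI : IsIntegral B.X.left :=
    haveI := B.geometricallyIntegral
    GeometricallyIntegral.isIntegral_of_subsingleton B.X.hom
  haveI : IsIntegral (pullback 𝒜.X.hom xb) := ‹IsIntegral B.X.left›
  have hLf : IsFiniteLocallyFree ((Scheme.Modules.pullback (pullback.fst 𝒜.X.hom xb)).obj L) :=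
    (HasRank.isFiniteLocallyFree' hL).pullback _
  -- class ⇒ isomorphism with `𝒪(Θ)` (rank-one modules on the integral fibre)
  have e : Nonempty ((Scheme.Modules.pullback (pullback.fst 𝒜.X.hom xb)).obj L ≅ 𝒜.lineBundleOfDivisor xb Θ) := by
    refine (nonempty_iso_iff_detClass_eq (hasRank_pullback _ hL) Θ.toUnitCocycle.hasRank_lineBundle hLf
      Θ.toUnitCocycle.isFiniteLocallyFree_lineBundle).2 ?_
    rw [detClass_lineBundle_toUnitCocycle, ← hcl, detClass_pullback _ (HasRank.isFiniteLocallyFree' hL)]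
  exact 𝒜.exists_affineOpen_isClosedImmersion_toProj_tensorPow_three_of_symmetric_isAmple L hL F h1 x xb hx hΘ hsym e

end Chart

/-! ## §2 The spread over a Dedekind base of characteristic `0` -/

/-- **REL-EMB-SPREAD for a rank-one `L` with symmetric ample char-`0` class witnesses, over a Dedekind base** ([EGAIII1] (4.7.1) at every point of the
generic fibre + [EGAIV3] (9.2)): `T` Noetherian, `q : T → Spec B` locally of finite type, `B` Dedekind of characteristic `0`, `𝒜∕T` abelian, `L` rank
one on `A` with a rank-one frame system `F` of `L^{⊗3}`, and at every algebraically closed char-`0` point `x̄` of `T` an ample `Θ` with `(−1)^*Θ ∼ Θ` and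
`[L|_{A_x̄}] = [Θ]`.  THEN there is an open `𝒱 ⊆ T` with (i) `q(T ∖ 𝒱)` a FINITE set of primes, (ii) `𝒱 ⊇` the generic fibre, (iii) every `t ∈ 𝒱` in an
affine open `Spec R ↪ 𝒱` (`R` Noetherian) over which, for every cartesian square `A′ = A ×_T Spec R`, finitely many sections of `L^{⊗3}|_{A′}`
generate it and define a CLOSED IMMERSION `A′ ↪ ℙ^m_R` over `Spec R`.  (★ §4′ of `PolarizedAbelianSchemeLocalEmbedding` with the chart step §1.)
[cite: EGAIII1, Thm. (4.7.1) p. 145] [cite: EGAIV3, (9.2.1)–(9.2.3)] [cite: StacksProject, Tag 00FE] [cite: MumfordFogartyKirwan1994, Ch. 7 §2 Prop. 7.6 (p. 136)] -/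
theorem exists_opens_finite_image_compl_forall_affineOpen_isClosedImmersion_toProj_of_cechClass
    {B : Type} [CommRing B] [IsDedekindDomain B] [CharZero B] {T : Scheme.{0}} [IsNoetherian T]
    (q : T ⟶ Spec (.of B)) [LocallyOfFiniteType q] (𝒜 : AbelianSchemeOver T) (L : 𝒜.X.left.Modules) (hL : HasRank L 1)
    (F : FrameSystem (tensorPow L 3)) (h1 : ∀ x, F.rank x = 1)
    (hwit : ∀ ⦃Ω : Type⦄ [Field Ω] [IsAlgClosed Ω] [CharZero Ω] (xb : Spec (.of Ω) ⟶ T),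
      ∃ Θ : CartierDivisor (𝒜.fibre xb).toAbelianVariety.X.left, Θ.IsAmple ∧
        (Θ.pullback (AbelianVariety.Hom.toSchemeHom (-𝟙 (𝒜.fibre xb).toAbelianVariety))).LinEquiv Θ ∧
        CechPic.pullback (X := (𝒜.fibre xb).toAbelianVariety.X.left) (pullback.fst 𝒜.X.hom xb)
          (detClass (HasRank.isFiniteLocallyFree' hL)) = Θ.cechClass) :
    ∃ 𝒱 : T.Opens, (q '' ((𝒱 : Set T)ᶜ)).Finite ∧ (∀ t : T, (q t).asIdeal = ⊥ → t ∈ 𝒱) ∧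
      ∀ t ∈ 𝒱, ∃ (R : Type) (_ : CommRing R) (_ : IsNoetherianRing R) (ι : Spec (.of R) ⟶ T) (_ : IsOpenImmersion ι),
        t ∈ Set.range ι ∧ Set.range ι ⊆ (𝒱 : Set T) ∧
        ∀ {X' : Scheme.{0}} (i' : X' ⟶ 𝒜.X.left) (f' : X' ⟶ Spec (.of R)), IsPullback i' f' 𝒜.X.hom ι →
          ∃ (m : ℕ) (b : Fin (m + 1) → Γ((Scheme.Modules.pullback i').obj (tensorPow L 3), ⊤))
            (hcov' : ⨆ i, ⨆ z, X'.basicOpen ((CocycleSections.ofFrameSystem (F.pullback i') (fun z ↦ h1 (i'.base z))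
              b).coeff i z) = ⊤),
            IsClosedImmersion ((ofCocycleSections (F.pullback i').U (CocycleSections.ofFrameSystem (F.pullback i')
              (fun z ↦ h1 (i'.base z)) b) hcov').toProj f') := by
  classical
  -- the chart at every point over the generic point: `κ(t)` has characteristic `0`, so has its algebraic closure
  have key : ∀ t : T, (q t).asIdeal = ⊥ →
      ∃ (R : Type) (_ : CommRing R) (_ : IsNoetherianRing R) (ι : Spec (.of R) ⟶ T) (_ : IsOpenImmersion ι), t ∈ Set.range ι ∧
        ∀ {X' : Scheme.{0}} (i' : X' ⟶ 𝒜.X.left) (f' : X' ⟶ Spec (.of R)), IsPullback i' f' 𝒜.X.hom ι →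
          ∃ (m : ℕ) (b : Fin (m + 1) → Γ((Scheme.Modules.pullback i').obj (tensorPow L 3), ⊤))
            (hcov' : ⨆ i, ⨆ z, X'.basicOpen ((CocycleSections.ofFrameSystem (F.pullback i') (fun z ↦ h1 (i'.base z))
              b).coeff i z) = ⊤),
            IsClosedImmersion ((ofCocycleSections (F.pullback i').U (CocycleSections.ofFrameSystem (F.pullback i')
              (fun z ↦ h1 (i'.base z)) b) hcov').toProj f') := fun t ht ↦ by
    haveI := charZero_residueField_of_apply_eq_bot q t ht
    let Ω : Type := AlgebraicClosure (T.residueField t)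
    let xb : Spec (.of Ω) ⟶ T := Spec.map (CommRingCat.ofHom (algebraMap (T.residueField t) Ω)) ≫ T.fromSpecResidueField t
    have hx : t ∈ Set.range xb := ⟨IsLocalRing.closedPoint Ω, by
      change (Spec.map _ ≫ T.fromSpecResidueField t) _ = t
      rw [Scheme.Hom.comp_apply, Scheme.fromSpecResidueField_apply]⟩
    haveI : CharZero Ω := charZero_of_injective_algebraMap (algebraMap (T.residueField t) Ω).injective
    obtain ⟨Θ, hΘ, hsym, hcl⟩ := hwit xb
    exact 𝒜.exists_affineOpen_isClosedImmersion_toProj_tensorPow_three_of_cechClass L hL F h1 t xb hx hΘ hsym hcl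
  choose R instR instN ι instι hmem hemb using key
  -- the open: the union of the charts
  let 𝒱 : T.Opens := ⨆ (t : T), ⨆ (ht : (q t).asIdeal = ⊥), (ι t ht).opensRange
  refine ⟨𝒱, ?_, fun t ht ↦ ?_, fun t ht𝒱 ↦ ?_⟩
  · -- `T ∖ 𝒱` is constructible and misses the generic fibre
    have h𝒱c : IsConstructible ((𝒱 : Set T)ᶜ) :=
      isConstructible_compl.mpr (IsRetrocompact.isConstructible 𝒱.isOpen fun U _ _ ↦ NoetherianSpace.isCompact _)
    refine finite_image_of_isConstructible_of_bot_notMem_of_finiteType q h𝒱c ?_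
    rintro ⟨t, htZ, hqt⟩
    apply htZ
    have ht : (q t).asIdeal = ⊥ := by rw [hqt]; rfl
    change t ∈ 𝒱
    exact Opens.mem_iSup.mpr ⟨t, Opens.mem_iSup.mpr ⟨ht, hmem t ht⟩⟩
  · exact Opens.mem_iSup.mpr ⟨t, Opens.mem_iSup.mpr ⟨ht, hmem t ht⟩⟩
  · obtain ⟨t', ht'⟩ := Opens.mem_iSup.mp ht𝒱
    obtain ⟨hq, htm⟩ := Opens.mem_iSup.mp ht'
    refine ⟨R t' hq, instR t' hq, instN t' hq, ι t' hq, instι t' hq, htm, ?_, fun i' f' H ↦ hemb t' hq i' f' H⟩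
    intro z hz
    change z ∈ 𝒱
    exact Opens.mem_iSup.mpr ⟨t', Opens.mem_iSup.mpr ⟨hq, hz⟩⟩

/-! ## §3 Read as projectivity of the chart schemes -/

/-- **On `𝒱`, every point has an affine chart over which `A` is PROJECTIVE** (Hartshorne ∕ H-projective, ★ `IsProjective`): the closed immersion
`A ×_T Spec R ↪ ℙ^m_R` of §2 at the chosen cartesian square `pullback 𝒜.X.hom ι` makes `pullback.snd 𝒜.X.hom ι : A ×_T Spec R → Spec R` projective
(★ `IsProjective.of_generatingSections`) — the binder `hA` of the DUALS letter for `𝒜.baseChange ι` (whose structure map IS `pullback.snd`, ★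
`baseChange_hom`). [cite: EGAIII1, Thm. (4.7.1) p. 145] [cite: Hartshorne1977, II §4 Definition p. 103 (projective morphism)] -/
theorem exists_opens_finite_image_compl_forall_affineOpen_isProjective_of_cechClass
    {B : Type} [CommRing B] [IsDedekindDomain B] [CharZero B] {T : Scheme.{0}} [IsNoetherian T]
    (q : T ⟶ Spec (.of B)) [LocallyOfFiniteType q] (𝒜 : AbelianSchemeOver T) (L : 𝒜.X.left.Modules) (hL : HasRank L 1)
    (F : FrameSystem (tensorPow L 3)) (h1 : ∀ x, F.rank x = 1)
    (hwit : ∀ ⦃Ω : Type⦄ [Field Ω] [IsAlgClosed Ω] [CharZero Ω] (xb : Spec (.of Ω) ⟶ T),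
      ∃ Θ : CartierDivisor (𝒜.fibre xb).toAbelianVariety.X.left, Θ.IsAmple ∧
        (Θ.pullback (AbelianVariety.Hom.toSchemeHom (-𝟙 (𝒜.fibre xb).toAbelianVariety))).LinEquiv Θ ∧
        CechPic.pullback (X := (𝒜.fibre xb).toAbelianVariety.X.left) (pullback.fst 𝒜.X.hom xb)
          (detClass (HasRank.isFiniteLocallyFree' hL)) = Θ.cechClass) :
    ∃ 𝒱 : T.Opens, (q '' ((𝒱 : Set T)ᶜ)).Finite ∧ (∀ t : T, (q t).asIdeal = ⊥ → t ∈ 𝒱) ∧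
      ∀ t ∈ 𝒱, ∃ (R : Type) (_ : CommRing R) (_ : IsNoetherianRing R) (ι : Spec (.of R) ⟶ T) (_ : IsOpenImmersion ι),
        t ∈ Set.range ι ∧ Set.range ι ⊆ (𝒱 : Set T) ∧ IsProjective (pullback.snd 𝒜.X.hom ι) := by
  obtain ⟨𝒱, hfin, hgen, hchart⟩ :=
    𝒜.exists_opens_finite_image_compl_forall_affineOpen_isClosedImmersion_toProj_of_cechClass q L hL F h1 hwit
  refine ⟨𝒱, hfin, hgen, fun t ht ↦ ?_⟩
  obtain ⟨R, _, _, ι, _, htι, hι𝒱, hemb⟩ := hchart t ht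
  obtain ⟨m, b, hcov', hci⟩ := hemb (pullback.fst 𝒜.X.hom ι) (pullback.snd 𝒜.X.hom ι) (IsPullback.of_hasPullback _ _)
  exact ⟨R, inferInstance, inferInstance, ι, inferInstance, htι, hι𝒱, IsProjective.of_generatingSections _ _ hci⟩

end AbelianSchemeOver

end Literature.AlgebraicGeometry.AbelianSchemes

end
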